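import Summits.BirchSwinnertonDyer.BirchSwinnertonDyer.Theses.SignedLowerHalves
import Literature.NumberTheory.EllipticCurves.Rank1Residual.MuLambdaCarriers
import Literature.NumberTheory.EllipticCurves.FineSelmerMuRoadDoors
import Literature.NumberTheory.IwasawaTheory.ClassicalMuVanishesDivisionFieldThree
import Literature.NumberTheory.EllipticCurves.FineSelmerIsotypicClassGroupCriterion
import Literature.NumberTheory.EllipticCurves.Rank1Residual.FineMordellWeilCertificates
import Literature.NumberTheory.EllipticCurves.Rank1Residual.Typed.X7
import Summits.BirchSwinnertonDyer.BirchSwinnertonDyer.Theorems.AdditiveBranchIMCGordTwoRankOneSmallImageDickson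
import Summits.BirchSwinnertonDyer.BirchSwinnertonDyer.Theorems.SignedLowerHalvesSmallImageMuZeroOneSignFinePivotOneSign
import HarnessLib

/-!
# Line `fine_pivot` — crux M `SmallImageMuZeroOneSign` (item stmt-BirchSwinnertonDyer-23600; route `SignedLowerHalves` (K3),
# crux rank 402, the `μ`-resplit child of crux 4 `KobayashiMainConjectureSmallImage`)

Ideator seat bsd-idea-5 (planner, lens «transfer»), generations g11–g12, 2026-08-29 (v1.4 = v1.3 + §«Door 1‴»: FACT-FREE per-pair
doors via the conjA-anchor kernel theorems `CoatesSujatha2005.conjA_of_not_dvd_card_classGroup` / `…_of_eigenHom_subfield`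
(p688359) — one class number + `CleanAtP` ⟹ `ConjAAt` by name, then M at the pair modulo S1 + Kobayashi's HELD print only; + the
support stub `stub_cleanAtP_goodSS`; v1.5 = v1.4 + §«Door 1⁗»: the LEAD cruxlead-23600 g2 LANDED the S1 lever in the kernel —
`Theorems.SmallImageFinePivot.oneSignMuZero_of_conjAAt` (p689959 ff.; print binders hKP/hKo/hMa) — so the per-pair certificate and
chain B are now composed through it: crux M AT A PAIR from one class number + `CleanAtP` modulo PRINT ONLY, and chain B = S3′ + S2′ +
print with NO S1 stub; `stub_minSignAbsorption` stays as typed but is no longer load-bearing).  PUBLISH-ONLY skeleton (W-79: the crux has a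
LEAD and a line of record `Lines/birth_mu.lean` v2 (7f4df4aa81366869); this file is NOT registered with `ledger skeleton check`
by the ideator).  It realises the crux idea «fine-pivot-minsign» (bsd-idea-5 g10, critic idea-crit-10 V#133/V#133a/V#133b:
PASS as idea, cleared for LINE filing) as a checked skeleton, and adds g11's sharpening (the torsion-point-field chain B).

THE LINE (sign-free, `L`-function-free, residual by construction).  M asks, at every small-image supersingular X7 pair
(odd `p`, `ClassX7`, non-CM, `a_p = 0`, `ρ̄_{E,p}` not onto — i.e. `im ρ̄ ⊆ N(C_ns(p))`, `ρ̄ ⊗ 𝔽_{p²} ≅ Ind_K^ℚ ψ̄`, `p` inert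
in `K`), for SOME sign `ε`, algebraic `μ(X^ε(E/ℚ_∞)) = 0`.

* **S1 `stub_minSignAbsorption` (the lever, M-sized, image-free).**  `μ(X₀(E/ℚ_∞)) = 0` (the `μ`-form of Coates–Sujatha's
  statement (A) AT THE PAIR) ⟹ `∃ ε, μ(X^ε) = 0`.  Proof (card §S1): residually, the local image `G` of the global classes in the
  plane `H¹(ℚ_{∞,p}, E[p])` (generic `𝔽_p((T))`-dimension 2) is a LINE (Poitou–Tate: the torsion of `H¹(ℚ_Σ/ℚ_∞, E[p^∞])^∨` is
  `X₀` up to twist, Kato's weak Leopoldt), and Kobayashi's two conditions `ℒ⁺ ≠ ℒ⁻` are two distinct lines (`E⁺ ∩ E⁻ = E(ℚ_p)`,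
  `E⁺ + E⁻ = ` everything); a line lies in at most one of them, so `min_ε μ-rank(X^ε) = μ-rank(X₀)`.
* **Chain A (g10): S3 `stub_divisionFieldMu`** — Iwasawa's `μ = 0` for the cyclotomic `ℤ_p`-extension of `ℚ(E[p]) = K(ψ̄)` on the
  domain (OPEN: the field is abelian over `K` with `p` INERT — the non-split analogue of Ferrero–Washington / Gillard) — and the
  HELD print door **`stub_printedInputsFine`** (Coates–Sujatha 2005 Thm. 3.4 = `CoatesSujatha2005.thm34_…`, with Kobayashi's
  construction / torsion facts used by S1).  Composition `SmallImageMuZeroOneSign_of` (BY NAME, no sorry of its own).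
* **Chain B (g11 sharpening): S3′ `stub_torsionPointFieldMu`** — `μ = 0` for the cyclotomic `ℤ_p`-extension of ONE field between
  `ℚ` and `ℚ(E[p])` fixed by an element `σ̄` stabilising a non-zero `p`-torsion point (best: `ℚ(P)`, degree `p² − 1`, half of
  `ℚ(E[p])`; at `p = 5` the single field `ℚ(P₁)` of degree 24 instead of the seven Kuroda fields of
  `classicalMuVanishes_divisionField_of_nonsplitCartanBasis_five`) — WEAKER than S3 — and **S2′ `stub_torsionPointFieldDescent`**:
  S3′ ⟹ statement (A) at the pair (prime-to-`p` ISOTYPIC descent: `|Gal(ℚ(E[p])/ℚ)|` divides `2(p²−1)`, so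
  `R(E[p]/ℚ_∞) = Hom_{Gal}(X^{cs}(ℚ(E[p])_∞)/p, ρ̄)` and `X(F'_∞) = X(ℚ(E[p])_∞)^{⟨σ̄⟩}` with `ρ̄^{⟨σ̄⟩} ∋ P ≠ 0`; paper proof in
  the card; Lean proof modulo a residual form of CS05 §3).  Composition `SmallImageMuZeroOneSign_of_torsionPointField`.

EXACT WALL (card §3, informal theorem): on the domain, M(E,p) ⟺ (A)(E,p) ⟺ `μ` of the `ρ̄`-ISOTYPIC component of the unramified
Iwasawa module of `ℚ(E[p])^{cyc}` vanishes (equivalently, by Rubin 1991 Thm. 4.1 at inert `p`, the `ψ̄`-part of global units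
modulo elliptic units has `μ = 0` up the cyclotomic tower).  So the LEAD's open analytic stub `stub_muAnOneSignGeFive_ns`
(one-signed Perrin-Riou / Pollack Conj. 6.3 on the class) and this line's S3′ are two currencies for ONE wall.

HONEST: crux M, crux 4 and BSD are OPEN / not proved by any of this; nothing below asserts a held fact or an open stub.
-/

set_option autoImplicit false
set_option linter.dupNamespace false

noncomputable section

open scoped NumberField

namespace Summit.BirchSwinnertonDyer.BirchSwinnertonDyer.Cruxes.SmallImageMuZeroOneSign.FinePivot

open Field IntermediateField WeierstrassCurve Literature.NumberTheory.EllipticCurves Literature.NumberTheory.GaloisRepresentations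
  Literature.NumberTheory.EllipticCurves.Rank1Residual Literature.NumberTheory.IwasawaTheory
  Summit.BirchSwinnertonDyer.BirchSwinnertonDyer.Theses.SignedLowerHalves

/-! ## Statements (Props; nothing asserted) -/

/-- The conclusion of crux M AT ONE PAIR: some sign `ε` has algebraic `μ(X^ε(E/ℚ_∞)) = 0` (spelling copied from
`SignedLowerHalves.SmallImageMuZeroOneSign`). -/
def OneSignMuZeroAt (W : WeierstrassCurve ℚ) [W.IsElliptic] [W.IsGloballyMinimal] (p : ℕ) [Fact p.Prime] : Prop :=
  ∃ ε : ℤˣ, ∀ (κ : ZpExtension ℚ p) (γ : Field.absoluteGaloisGroup ℚ),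
    κ.IsCyclotomic → κ.IsTopGenerator γ → IsCyclotomicVariable p γ →
    ∀ (D : Kobayashi2003.SignedSelmerDualData W κ γ ε) (ξ : IwasawaAlgebra p),
      D.charIdeal = Ideal.span {ξ} → Summit.BirchSwinnertonDyer.Rank1Residual.X1.MuLambda.mu ξ = 0

/-- **S1 — MIN-SIGN ABSORPTION** (the lever; image-free): granted Kobayashi's signed Coleman–Kato construction fact and Thm. 1.2
(antecedent, HELD print), for `E/ℚ`, `p` odd of good supersingular reduction with `a_p = 0`: pointwise `μ(X₀(E/ℚ_∞)) = 0`
(`FineMuZeroAt`) ⟹ `μ(X^ε(E/ℚ_∞)) = 0` for SOME sign.  [cite: Kobayashi2003, Thm. 1.2, Thm. 6.2, Prop. 8.12, (7.21)]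
[cite: Kato2004Asterisque, Thm. 12.4, §13.8] [cite: CoatesSujatha2005, §3 statement (A)] -/
def MinSignAbsorption : Prop :=
  (Kobayashi2003.thm62_63_73_signedColemanKato_zeta ∧ Kobayashi2003.thm12_signedSelmerDual_finite_torsion) →
  ∀ (W : WeierstrassCurve ℚ) [W.IsElliptic] [W.IsGloballyMinimal] (p : ℕ) [Fact p.Prime],
    p ≠ 2 → GoodSS W p → W.frobeniusTrace p = 0 → FineMuZeroAt W p → OneSignMuZeroAt W p

/-- **S3 (chain A) — `μ = 0` for `ℚ(E[p])^{cyc}` on the domain** (g10's `DivisionFieldMuOnSmallImageSS`): at every pair of M's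
domain, Iwasawa's `μ`-invariant of the cyclotomic `ℤ_p`-extension of the `K`-abelian field `ℚ(E[p]) = K(ψ̄)` (`p` inert in `K`)
vanishes.  OPEN (non-split analogue of Ferrero–Washington 1979 / Gillard 1985). [cite: FerreroWashington1979, Theorem]
[cite: CoatesSujatha2005, Thm. 3.4 and Cor. 3.6] -/
def DivisionFieldMuOnSmallImageSS : Prop :=
  ∀ (W : WeierstrassCurve ℚ) [W.IsElliptic] [W.IsGloballyMinimal] (p : ℕ) [Fact p.Prime],
    p ≠ 2 → ClassX7 W p → ¬ W.HasCM → W.frobeniusTrace p = 0 → ¬ Surj W p →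
    (haveI : NeZero p := ⟨(Fact.out : p.Prime).ne_zero⟩
     haveI : NumberField ↥(W.divisionField p) := NumberField.mk
     ∀ κL : ZpExtension ↥(W.divisionField p) p, κL.IsCyclotomic → ClassicalMuVanishes κL)

/-- **`TorsionPointFieldMuAt W p` — `μ = 0` for ONE torsion-point field** (chain B's input at the pair): there are `σ ∈ Γ_ℚ` and a
non-zero `P ∈ E[p]` with `σ • P = P` such that Iwasawa's `μ` vanishes for every cyclotomic `ℤ_p`-extension of the subfield of
`ℚ(E[p])` fixed by `σ̄ = σ|_{ℚ(E[p])}`.  (With `σ̄` generating the stabiliser of `P` this field is `ℚ(P)`, of degree `p² − 1` when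
`im ρ̄ = N(C_ns(p))`; with `σ̄ = 1` it is `ℚ(E[p])` itself, so `DivisionFieldMuOnSmallImageSS` implies it pairwise.)
[cite: CoatesSujatha2005, §3] [cite: Serre1972, §2.2] -/
def TorsionPointFieldMuAt (W : WeierstrassCurve ℚ) [W.IsElliptic] (p : ℕ) [Fact p.Prime] : Prop :=
  haveI : NeZero p := ⟨(Fact.out : p.Prime).ne_zero⟩
  haveI : NumberField ↥(W.divisionField p) := NumberField.mk
  ∃ (σ : Field.absoluteGaloisGroup ℚ) (P : W.geomTorsion p), P ≠ 0 ∧ σ • P = P ∧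
    ∀ κL : ZpExtension ↥(fixedField (Subgroup.zpowers (absRestrictNormalHom (W.divisionField p) σ))) p,
      κL.IsCyclotomic → ClassicalMuVanishes κL

/-- **S3′ (chain B) — `μ = 0` for one torsion-point field, on the domain.**  OPEN, WEAKER than S3 (one field of degree `p² − 1`
instead of `ℚ(E[p])`; Iwasawa's conjecture for a non-Galois field whose Galois closure is `ℚ(E[p])`). [cite: CoatesSujatha2005, §3]
[cite: FerreroWashington1979, Theorem] -/
def TorsionPointFieldMuOnSmallImageSS : Prop :=
  ∀ (W : WeierstrassCurve ℚ) [W.IsElliptic] [W.IsGloballyMinimal] (p : ℕ) [Fact p.Prime],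
    p ≠ 2 → ClassX7 W p → ¬ W.HasCM → W.frobeniusTrace p = 0 → ¬ Surj W p → TorsionPointFieldMuAt W p

/-- **S2′ (chain B) — PRIME-TO-`p` ISOTYPIC DESCENT**: on M's domain (there `|Gal(ℚ(E[p])/ℚ)|` divides `2(p² − 1)`, prime to `p`,
and `ρ̄` is irreducible), `TorsionPointFieldMuAt W p` ⟹ statement (A) at the pair.  Paper proof: `R(E[p]/ℚ_∞) =
Hom_{Gal(F/ℚ)}(X^{cs}(F_∞)/p, E[p])` (`F = ℚ(E[p])`, inflation–restriction is exact for the prime-to-`p` group), `X(F'_∞)[p^∞] ≅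
X(F_∞)^{⟨σ̄⟩}` for `F' = F^{⟨σ̄⟩}`, and `ρ̄^{⟨σ̄⟩} ∋ P ≠ 0`, so `μ(F'_∞) = 0` kills the `ρ̄`-isotypic `μ`; then Kato's torsion gives (A).
Lean: modulo a residual form of Coates–Sujatha §3 (typist ask). [cite: CoatesSujatha2005, Thm. 3.4 (proof), Lemma 3.8]
[cite: LimSujatha2018, Prop. 3.2] [cite: Kato2004Asterisque, Thm. 12.4] -/
def TorsionPointFieldDescent : Prop :=
  ∀ (W : WeierstrassCurve ℚ) [W.IsElliptic] [W.IsGloballyMinimal] (p : ℕ) [Fact p.Prime],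
    p ≠ 2 → ClassX7 W p → ¬ W.HasCM → W.frobeniusTrace p = 0 → ¬ Surj W p → TorsionPointFieldMuAt W p → ConjAAt W p

/-- **Support (g12) — (c3) at a good supersingular odd prime**: `GoodSS W p`, `p ≠ 2` ⟹ `CleanAtP W p` (`E(ℚ_p)[p] = 0`).
Paper proof: `E(ℚ_p)[p] ↪ Ẽ(𝔽_p)` (the formal group `Ê(pℤ_p)` is torsion-free for `p` odd, AEC IV.6.4 / VII.3.1) and
`#Ẽ(𝔽_p) = p + 1 − a_p ≡ 1 (mod p)`; or: inertia at a supersingular prime acts on `E[p]` through the level-two fundamental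
characters (tree `WeierstrassCurve.hasLevelTwoInertiaShape_restrictField_of_dvd_frobeniusTraceAt`), so `E[p]^{I_p} = 0`.
The (c3)-input of the Door 1‴ certificates below; S-sized. [cite: Silverman2009AEC, VII.3.1 and IV.6.4] [cite: Serre1972, §1.11 Prop. 12]
[cite: DeoRaySujatha2023, §3 hypothesis (c3) (arXiv:2202.09937 p. 9)] -/
def CleanAtPOnGoodSS : Prop :=
  ∀ (W : WeierstrassCurve ℚ) [W.IsElliptic] [W.IsGloballyMinimal] (p : ℕ) [Fact p.Prime], p ≠ 2 → GoodSS W p → CleanAtP W p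

/-! ## Stubs (sorried; `stub_printedInputsFine` is HELD print, never a prover target) -/

/-- stub (HELD, cite-only — PUBLISHED named facts, none with `_holds`): Kobayashi 2003 Thm. 6.2/6.3/7.3 (signed Coleman–Kato
construction fact), Thm. 1.2 (signed Selmer duals f.g. torsion), and Coates–Sujatha 2005 Thm. 3.4 (statement (A) over `ℚ^{cyc}`
from `μ = 0` of `ℚ(E[p])^{cyc}`). [cite: Kobayashi2003, Thm. 1.2, Thm. 6.2–6.3, Thm. 7.3] [cite: CoatesSujatha2005, Thm. 3.4] -/
theorem stub_printedInputsFine :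
    Kobayashi2003.thm62_63_73_signedColemanKato_zeta ∧ Kobayashi2003.thm12_signedSelmerDual_finite_torsion ∧
    CoatesSujatha2005.thm34_fineSelmerDual_moduleFinite_of_classicalMuVanishes_divisionField := by
  sorry

/-- stub S1 — min-sign absorption (the lever; M-sized; provable: two lines in a plane, card §S1).
[cite: Kobayashi2003, Prop. 8.12, (7.21)] [cite: Kato2004Asterisque, Thm. 12.4] -/
theorem stub_minSignAbsorption : MinSignAbsorption := by
  -- v1.5: NO LONGER LOAD-BEARING — the lever is LANDED by the LEAD (cruxlead-23600 g2) as
  -- `Theorems.SmallImageFinePivot.oneSignMuZero_of_conjAAt` (binders hKP/hKo/hMa, input `ConjAAt`); this μ-form with Kobayashi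
  -- binders is kept as typed (provable from the LEAD's files + the structure-theorem step `FineMuZeroAt → ConjAAt`), cite-only.
  sorry

/-- stub S3 — `μ = 0` for `ℚ(E[p])^{cyc}` on the domain (chain A's wall; XL / OPEN: non-split Ferrero–Washington).
[cite: FerreroWashington1979, Theorem] [cite: CoatesSujatha2005, Cor. 3.6] -/
theorem stub_divisionFieldMu : DivisionFieldMuOnSmallImageSS := by
  sorry

/-- stub S3′ — `μ = 0` for one torsion-point field on the domain (chain B's wall; XL / OPEN, weaker than S3).
[cite: CoatesSujatha2005, §3] -/
theorem stub_torsionPointFieldMu : TorsionPointFieldMuOnSmallImageSS := by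
  sorry

/-- stub S2′ — prime-to-`p` isotypic descent (M-sized; paper-provable, card §S2′). [cite: CoatesSujatha2005, Thm. 3.4 (proof)]
[cite: LimSujatha2018, Prop. 3.2] -/
theorem stub_torsionPointFieldDescent : TorsionPointFieldDescent := by
  sorry

/-- stub (support, g12) — `E(ℚ_p)[p] = 0` at a good supersingular odd prime (S-sized; reduction mod `p` + Hasse, or the tree's
level-two inertia shape). [cite: Silverman2009AEC, VII.3.1] [cite: Serre1972, §1.11 Prop. 12] -/
theorem stub_cleanAtP_goodSS : CleanAtPOnGoodSS := by
  sorry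

/-! ## Compositions (no sorry of their own; conclusion = the route decl BY NAME) -/

/-- Statement (A) on the domain gives M, via S1 (kernel of both chains). [cite: CoatesSujatha2005, §3 statement (A)] -/
theorem smallImageMuZeroOneSign_of_conjA (h1 : MinSignAbsorption)
    (hpr : Kobayashi2003.thm62_63_73_signedColemanKato_zeta ∧ Kobayashi2003.thm12_signedSelmerDual_finite_torsion)
    (hA : ∀ (W : WeierstrassCurve ℚ) [W.IsElliptic] [W.IsGloballyMinimal] (p : ℕ) [Fact p.Prime],
      p ≠ 2 → ClassX7 W p → ¬ W.HasCM → W.frobeniusTrace p = 0 → ¬ Surj W p → ConjAAt W p) :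
    SmallImageMuZeroOneSign := by
  intro W _ _ p _ hp h7 hcm hap hns
  exact h1 hpr W p hp h7.1 hap ((hA W p hp h7 hcm hap hns).fineMuZeroAt)

/-- **THE SKELETON (chain A)**: crux M `SmallImageMuZeroOneSign` BY NAME from `stub_printedInputsFine` (HELD),
`stub_minSignAbsorption` (S1) and `stub_divisionFieldMu` (S3). [cite: CoatesSujatha2005, Thm. 3.4] [cite: Kobayashi2003, Thm. 1.2] -/
theorem SmallImageMuZeroOneSign_of : SmallImageMuZeroOneSign := by
  obtain ⟨hCK, h12, hCS⟩ := stub_printedInputsFine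
  refine smallImageMuZeroOneSign_of_conjA stub_minSignAbsorption ⟨hCK, h12⟩ ?_
  intro W _ _ p _ hp h7 hcm hap hns κ hκ
  exact hCS W p hp (stub_divisionFieldMu W p hp h7 hcm hap hns) κ hκ

/-- **Chain B**: crux M BY NAME from the HELD Kobayashi facts, S1, S2′ (`stub_torsionPointFieldDescent`) and S3′
(`stub_torsionPointFieldMu`) — Coates–Sujatha Thm. 3.4 is not used as a statement (its proof is inside S2′).
[cite: CoatesSujatha2005, §3] [cite: Kobayashi2003, Thm. 1.2] -/
theorem SmallImageMuZeroOneSign_of_torsionPointField : SmallImageMuZeroOneSign := by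
  obtain ⟨hCK, h12, -⟩ := stub_printedInputsFine
  refine smallImageMuZeroOneSign_of_conjA stub_minSignAbsorption ⟨hCK, h12⟩ ?_
  intro W _ _ p _ hp h7 hcm hap hns
  exact stub_torsionPointFieldDescent W p hp h7 hcm hap hns (stub_torsionPointFieldMu W p hp h7 hcm hap hns)

/-! ## Hypothesis-form compositions (critic V#134 P1: the HELD print as HYPOTHESES, so the only sorries in the cone are the
genuine targets — the form a registering LEAD should prefer) -/

/-- Chain A, print as hypotheses: Kobayashi Thm 6.2/6.3/7.3 + Thm 1.2 + Coates–Sujatha Thm 3.4 ⟹ (S1, S3 ⊢) crux M BY NAME.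
[cite: Kobayashi2003, Thm. 1.2] [cite: CoatesSujatha2005, Thm. 3.4] -/
theorem SmallImageMuZeroOneSign_of_facts
    (hCK : Kobayashi2003.thm62_63_73_signedColemanKato_zeta) (h12 : Kobayashi2003.thm12_signedSelmerDual_finite_torsion)
    (hCS : CoatesSujatha2005.thm34_fineSelmerDual_moduleFinite_of_classicalMuVanishes_divisionField) :
    SmallImageMuZeroOneSign := by
  refine smallImageMuZeroOneSign_of_conjA stub_minSignAbsorption ⟨hCK, h12⟩ ?_
  intro W _ _ p _ hp h7 hcm hap hns κ hκ
  exact hCS W p hp (stub_divisionFieldMu W p hp h7 hcm hap hns) κ hκ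

/-- Chain B, print as hypotheses: Kobayashi Thm 6.2/6.3/7.3 + Thm 1.2 ⟹ (S1, S2′, S3′ ⊢) crux M BY NAME (no Coates–Sujatha statement).
[cite: Kobayashi2003, Thm. 1.2] [cite: CoatesSujatha2005, §3] -/
theorem SmallImageMuZeroOneSign_of_facts_torsionPointField
    (hCK : Kobayashi2003.thm62_63_73_signedColemanKato_zeta) (h12 : Kobayashi2003.thm12_signedSelmerDual_finite_torsion) :
    SmallImageMuZeroOneSign := by
  refine smallImageMuZeroOneSign_of_conjA stub_minSignAbsorption ⟨hCK, h12⟩ ?_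
  intro W _ _ p _ hp h7 hcm hap hns
  exact stub_torsionPointFieldDescent W p hp h7 hcm hap hns (stub_torsionPointFieldMu W p hp h7 hcm hap hns)

/-! ## Door 1″ — the per-pair FINITE CERTIFICATE of chain B (sorry-free modulo S1, S2′ as hypotheses)

On M's domain `p` has a UNIQUE prime in `ℚ(E[p])` (the decomposition group at the supersingular prime maps onto
`N(C_ns(p))`: inertia ↦ `C_ns(p)`, Frobenius ↦ the non-trivial coset), hence in every torsion-point field, and that prime
is totally ramified in the cyclotomic tower; so Iwasawa's 1956 criterion turns S3′ AT A PAIR into ONE class number: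
`p ∤ h(ℚ(P))`, `[ℚ(P):ℚ] = p² − 1` (24 at p = 5, 48 at p = 7, 120 at p = 11) — versus `h(ℚ(E[p]))` of degree `2(p²−1)`
for Door 1 (`FineSelmerMuRoadDoors`), whose Door 1′ needs a subfield of `p`-POWER index and so cannot see `ℚ(P)` (index 2). -/

/-- **Door 1″ (torsion-point-field class-number door), statement (A) form.**  Granted Iwasawa 1956 (`hIw`, named fact) and
S2′ (`h2`): on M's domain, if some `σ ∈ Γ_ℚ` fixes a non-zero `P ∈ E[p]`, the fixed field `L = ℚ(E[p])^{⟨σ̄⟩}` has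
`p ∤ h(L)` and exactly one prime above `p`, then statement (A) holds for `E` at `p`.
[cite: Greenberg2001IwasawaPastPresent, Prop. 2.1 p. 339] [cite: CoatesSujatha2005, §3] -/
theorem conjAAt_of_torsionPointField_classNumber
    (hIw : iwasawa1956_classNumberPExp_eq_zero_of_not_dvd_classNumber_of_unique_prime)
    (h2 : TorsionPointFieldDescent)
    (W : WeierstrassCurve ℚ) [W.IsElliptic] [W.IsGloballyMinimal] (p : ℕ) [Fact p.Prime] [NeZero p]
    (hp : p ≠ 2) (h7 : ClassX7 W p) (hcm : ¬ W.HasCM) (hap : W.frobeniusTrace p = 0) (hns : ¬ Surj W p)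
    (σ : Field.absoluteGaloisGroup ℚ) (P : W.geomTorsion p) (hP : P ≠ 0) (hσP : σ • P = P)
    (hh : haveI : NumberField ↥(W.divisionField p) := NumberField.mk
      ¬ p ∣ NumberField.classNumber ↥(fixedField (Subgroup.zpowers (absRestrictNormalHom (W.divisionField p) σ))))
    (hv : haveI : NumberField ↥(W.divisionField p) := NumberField.mk
      ∃! v : IsDedekindDomain.HeightOneSpectrum (𝓞 ↥(fixedField (Subgroup.zpowers (absRestrictNormalHom (W.divisionField p) σ)))),
        ((p : ℕ) : 𝓞 ↥(fixedField (Subgroup.zpowers (absRestrictNormalHom (W.divisionField p) σ)))) ∈ v.asIdeal) :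
    ConjAAt W p := by
  haveI : NumberField ↥(W.divisionField p) := NumberField.mk
  refine h2 W p hp h7 hcm hap hns ⟨σ, P, hP, hσP, ?_⟩
  intro κL _hκL
  exact classicalMuVanishes_of_classNumberPExp_eq_zero hIw hh hv κL

/-- **Door 1″, crux-M form at the pair**: the same certificate gives `∃ ε, μ(X^ε(E/ℚ_∞)) = 0` via S1 (`h1`) and Kobayashi's
construction/torsion facts (`hpr`, HELD print). [cite: Kobayashi2003, Thm. 1.2] [cite: Greenberg2001IwasawaPastPresent, Prop. 2.1] -/
theorem oneSignMuZeroAt_of_torsionPointField_classNumber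
    (hIw : iwasawa1956_classNumberPExp_eq_zero_of_not_dvd_classNumber_of_unique_prime)
    (hpr : Kobayashi2003.thm62_63_73_signedColemanKato_zeta ∧ Kobayashi2003.thm12_signedSelmerDual_finite_torsion)
    (h1 : MinSignAbsorption) (h2 : TorsionPointFieldDescent)
    (W : WeierstrassCurve ℚ) [W.IsElliptic] [W.IsGloballyMinimal] (p : ℕ) [Fact p.Prime] [NeZero p]
    (hp : p ≠ 2) (h7 : ClassX7 W p) (hcm : ¬ W.HasCM) (hap : W.frobeniusTrace p = 0) (hns : ¬ Surj W p)
    (σ : Field.absoluteGaloisGroup ℚ) (P : W.geomTorsion p) (hP : P ≠ 0) (hσP : σ • P = P)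
    (hh : haveI : NumberField ↥(W.divisionField p) := NumberField.mk
      ¬ p ∣ NumberField.classNumber ↥(fixedField (Subgroup.zpowers (absRestrictNormalHom (W.divisionField p) σ))))
    (hv : haveI : NumberField ↥(W.divisionField p) := NumberField.mk
      ∃! v : IsDedekindDomain.HeightOneSpectrum (𝓞 ↥(fixedField (Subgroup.zpowers (absRestrictNormalHom (W.divisionField p) σ)))),
        ((p : ℕ) : 𝓞 ↥(fixedField (Subgroup.zpowers (absRestrictNormalHom (W.divisionField p) σ)))) ∈ v.asIdeal) :
    OneSignMuZeroAt W p :=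
  h1 hpr W p hp h7.1 hap
    ((conjAAt_of_torsionPointField_classNumber hIw h2 W p hp h7 hcm hap hns σ P hP hσP hh hv).fineMuZeroAt)


/-! ## Door 1‴ (g12) — FACT-FREE per-pair doors via the conjA-anchor kernel theorems (p688359)

`Literature/NumberTheory/EllipticCurves/FineSelmerIsotypicClassGroupCriterion.lean` (conjA-anchor g17; THEOREMS, no named fact, no
sorry) proves statement (A) — in the tree's `∃ γ D, Module.Finite ℤ_[p] D.X` form, i.e. the body of `Rank1Residual.ConjAAt` — from
the door-L6 residual criterion `Hom_{Γ_ℚ}(Cl(ℚ(E[p])), E[p]) = 0`, `H²`-free.  On M's domain its side conditions are discharged BY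
NAME: (c1) `p ∤ #Gal(ℚ(E[p])/ℚ)` is `SmallImageDickson.not_dvd_card_aut_divisionField` (from `ClassX7.irr` + `¬ Surj`); (c3) at
`p` is `Rank1Residual.CleanAtP W p` (`E(ℚ_p)[p] = 0`, support stub `stub_cleanAtP_goodSS`).  Hence the per-pair certificate of
chain B needs NO Iwasawa-1956 fact and NO S2′: ONE integer — `h(ℚ(E[p]))` (degree `2(p²−1)`) or `h(ℚ(P))` (degree `p²−1`, the
kit currency of ASK-1′: 24 at p = 5) — plus `CleanAtP` gives `ConjAAt W p` KERNEL-COMPLETE, and `OneSignMuZeroAt W p` modulo S1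
and Kobayashi's HELD construction/torsion facts only.  (Door 1″ above is the Iwasawa-1956 road; it is superseded for
certificates but kept: its input `p ∤ h` + unique prime is the same integer.)  A certificate closes M AT A PAIR, never the
class-wide crux; `p | h(ℚ(P))` decides nothing (then the eigen-test `CoatesSujatha2005.conjA_of_eigenHom_subfield` /
`…_of_eigenclass` on `Cl(ℚ(P)) ⊗ 𝔽_p` is the next finite check). -/

/-- Folklore: every additive map from the class group of a number field `K` with `p ∤ h_K` to `ZMod p` is zero
(`h_K • a = 0`, `p • μ a = 0`, `gcd(h_K, p) = 1`). [folklore] [cite: NeukirchANT1999, Ch. I §6 Thm. (6.3)] -/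
theorem addMonoidHom_classGroup_zmod_eq_zero_of_not_dvd_classNumber {K : Type} [Field K] [NumberField K]
    {p : ℕ} (hpr : p.Prime) (hK : ¬ p ∣ NumberField.classNumber K)
    (μ : Additive (ClassGroup (𝓞 K)) →+ ZMod p) : μ = 0 := by
  have hc : NumberField.classNumber K = Nat.card (ClassGroup (𝓞 K)) := by
    unfold NumberField.classNumber
    exact Fintype.card_eq_nat_card
  rw [hc] at hK
  refine AddMonoidHom.ext fun a => ?_
  have ha : Nat.card (ClassGroup (𝓞 K)) • a = 0 := by
    rw [← ofMul_toMul a, ← ofMul_pow, pow_card_eq_one', ofMul_one]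
  have h1 : ((Nat.card (ClassGroup (𝓞 K)) : ℕ) : ℤ) • μ a = 0 := by
    rw [natCast_zsmul, ← map_nsmul, ha, map_zero]
  have h2 : ((p : ℕ) : ℤ) • μ a = 0 := by
    rw [natCast_zsmul, nsmul_eq_mul, ZMod.natCast_self, zero_mul]
  have hcop : IsCoprime (Nat.card (ClassGroup (𝓞 K)) : ℤ) (p : ℤ) :=
    Nat.isCoprime_iff_coprime.mpr (Nat.coprime_comm.mp ((Nat.Prime.coprime_iff_not_dvd hpr).mpr hK))
  obtain ⟨u, v, huv⟩ := hcop
  have h : (u * (Nat.card (ClassGroup (𝓞 K)) : ℤ) + v * (p : ℤ)) • μ a = 0 := by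
    rw [add_smul, mul_smul, mul_smul, h1, h2, smul_zero, smul_zero, add_zero]
  rwa [huv, one_smul] at h

/-- **Door 1‴a — `p ∤ h(ℚ(E[p]))` + `E(ℚ_p)[p] = 0` ⟹ statement (A) at the pair, FACT-FREE** (conjA-anchor kernel theorem
`CoatesSujatha2005.conjA_of_not_dvd_card_classGroup`; (c1) by `SmallImageDickson.not_dvd_card_aut_divisionField`).  On M's domain
(`p` odd, `ClassX7`, `¬ Surj`); `¬ HasCM` and `a_p = 0` are not needed for this step.
[cite: CoatesSujatha2005, §3 Thm. 3.4 and Lemma 3.8] [cite: DeoRaySujatha2023, §3 Thm. 3.9 (b), §5 Lemma 5.1 (arXiv:2202.09937 pp. 10, 17)]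
[cite: Serre1972, §2.4 Prop. 15] -/
theorem conjAAt_of_not_dvd_classNumber_divisionField
    (W : WeierstrassCurve ℚ) [W.IsElliptic] [W.IsGloballyMinimal] (p : ℕ) [Fact p.Prime] [NeZero p]
    (hp : p ≠ 2) (h7 : ClassX7 W p) (hns : ¬ Surj W p)
    (hh : haveI : NumberField ↥(W.divisionField p) := NumberField.mk
      ¬ p ∣ NumberField.classNumber ↥(W.divisionField p))
    (hc3 : CleanAtP W p) : ConjAAt W p := by
  haveI : NumberField ↥(W.divisionField p) := NumberField.mk
  have hc : NumberField.classNumber ↥(W.divisionField p) = Nat.card (ClassGroup (𝓞 ↥(W.divisionField p))) := by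
    unfold NumberField.classNumber
    exact Fintype.card_eq_nat_card
  rw [hc] at hh
  intro κ hκ
  exact CoatesSujatha2005.conjA_of_not_dvd_card_classGroup W hp
    (Theorems.AdditiveBranchIMCGordTwoRankOne.SmallImageDickson.not_dvd_card_aut_divisionField W p (ClassX7.irr W p hp h7) hns)
    hh hκ hc3

/-- **Door 1‴b — `p ∤ h(ℚ(P))` for ONE non-zero `P ∈ E[p]` + `E(ℚ_p)[p] = 0` ⟹ statement (A) at the pair, FACT-FREE**
(conjA-anchor kernel theorem `CoatesSujatha2005.conjA_of_eigenHom_subfield` with `K = ℚ(P)` = the fixed field, inside `ℚ(E[p])`, of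
the image of `Stab_{Γ_ℚ}(P)`; the eigen-test is discharged a fortiori by `p ∤ h(ℚ(P))`; (c1) by Dickson as in Door 1‴a).  This is
the consumer of the kit census ASK-1′ (`h(ℚ(P)) mod 5`, `[ℚ(P):ℚ] = 24` on the `5Nn` rows).
[cite: DeoRaySujatha2023, §3 Thm. 3.8 (c2), Thm. 3.9 (b) (arXiv:2202.09937 pp. 9–10)] [cite: CoatesSujatha2005, §3 Thm. 3.4 and Lemma 3.8]
[cite: NeukirchANT1999, Ch. I §6 Thm. (6.3)] -/
theorem conjAAt_of_not_dvd_classNumber_stabilizerField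
    (W : WeierstrassCurve ℚ) [W.IsElliptic] [W.IsGloballyMinimal] (p : ℕ) [Fact p.Prime] [NeZero p]
    (hp : p ≠ 2) (h7 : ClassX7 W p) (hns : ¬ Surj W p)
    (P : W.geomTorsion p) (hP : P ≠ 0)
    (hh : haveI : NumberField ↥(W.divisionField p) := NumberField.mk
      ¬ p ∣ NumberField.classNumber ↥(fixedField
        ((MulAction.stabilizer (Field.absoluteGaloisGroup ℚ) P).map (absRestrictNormalHom (W.divisionField p)))))
    (hc3 : CleanAtP W p) : ConjAAt W p := by
  haveI : NumberField ↥(W.divisionField p) := NumberField.mk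
  have hpr : p.Prime := Fact.out
  intro κ hκ
  refine CoatesSujatha2005.conjA_of_eigenHom_subfield W hp (ClassX7.irr W p hp h7)
    (Theorems.AdditiveBranchIMCGordTwoRankOne.SmallImageDickson.not_dvd_card_aut_divisionField W p (ClassX7.irr W p hp h7) hns)
    (fixedField ((MulAction.stabilizer (Field.absoluteGaloisGroup ℚ) P).map (absRestrictNormalHom (W.divisionField p))))
    P hP ?_ ?_ hκ hc3
  · -- `τ|_L` fixes `ℚ(P) = L^{Stab(P)|_L}`, so `τ|_L = τ₀|_L` with `τ₀ • P = P`, hence `τ • P = P`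
    intro τ hτ
    have hmem : absRestrictNormalHom (W.divisionField p) τ ∈
        (MulAction.stabilizer (Field.absoluteGaloisGroup ℚ) P).map (absRestrictNormalHom (W.divisionField p)) := by
      rw [← IntermediateField.fixingSubgroup_fixedField
        ((MulAction.stabilizer (Field.absoluteGaloisGroup ℚ) P).map (absRestrictNormalHom (W.divisionField p))),
        IntermediateField.mem_fixingSubgroup_iff]
      intro x hx
      exact hτ ⟨x, hx⟩
    obtain ⟨τ₀, hτ₀, hres⟩ := Subgroup.mem_map.mp hmem
    have h1 : absRestrictNormalHom (W.divisionField p) (τ₀⁻¹ * τ) = 1 := by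
      rw [map_mul, map_inv, hres, inv_mul_cancel]
    have h2 := (W.absRestrictNormalHom_divisionField_eq_one_iff p (τ₀⁻¹ * τ)).mp h1 P
    rw [mul_smul, inv_smul_eq_iff] at h2
    rw [h2]
    exact hτ₀
  · -- the eigen-test holds a fortiori: every additive `Cl(ℚ(P)) → ZMod p` vanishes when `p ∤ h(ℚ(P))`
    intro μ _
    exact addMonoidHom_classGroup_zmod_eq_zero_of_not_dvd_classNumber hpr hh μ

/-- **Door 1‴a, crux-M form at the pair**: `p ∤ h(ℚ(E[p]))` + `E(ℚ_p)[p] = 0` ⟹ `∃ ε, μ(X^ε(E/ℚ_∞)) = 0`, modulo S1 (`h1`) and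
Kobayashi's construction/torsion facts (`hpr`, HELD print) ONLY. [cite: Kobayashi2003, Thm. 1.2] [cite: CoatesSujatha2005, §3 Thm. 3.4] -/
theorem oneSignMuZeroAt_of_not_dvd_classNumber_divisionField
    (hpr : Kobayashi2003.thm62_63_73_signedColemanKato_zeta ∧ Kobayashi2003.thm12_signedSelmerDual_finite_torsion)
    (h1 : MinSignAbsorption)
    (W : WeierstrassCurve ℚ) [W.IsElliptic] [W.IsGloballyMinimal] (p : ℕ) [Fact p.Prime] [NeZero p]
    (hp : p ≠ 2) (h7 : ClassX7 W p) (hap : W.frobeniusTrace p = 0) (hns : ¬ Surj W p)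
    (hh : haveI : NumberField ↥(W.divisionField p) := NumberField.mk
      ¬ p ∣ NumberField.classNumber ↥(W.divisionField p))
    (hc3 : CleanAtP W p) : OneSignMuZeroAt W p :=
  h1 hpr W p hp h7.1 hap ((conjAAt_of_not_dvd_classNumber_divisionField W p hp h7 hns hh hc3).fineMuZeroAt)

/-- **Door 1‴b, crux-M form at the pair** (the ASK-1′ consumer): `p ∤ h(ℚ(P))` + `E(ℚ_p)[p] = 0` ⟹ `∃ ε, μ(X^ε(E/ℚ_∞)) = 0`,
modulo S1 (`h1`) and Kobayashi's construction/torsion facts (`hpr`, HELD print) ONLY — no Iwasawa-1956 fact, no S2′.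
[cite: Kobayashi2003, Thm. 1.2] [cite: DeoRaySujatha2023, §3 Thm. 3.9 (b)] -/
theorem oneSignMuZeroAt_of_not_dvd_classNumber_stabilizerField
    (hpr : Kobayashi2003.thm62_63_73_signedColemanKato_zeta ∧ Kobayashi2003.thm12_signedSelmerDual_finite_torsion)
    (h1 : MinSignAbsorption)
    (W : WeierstrassCurve ℚ) [W.IsElliptic] [W.IsGloballyMinimal] (p : ℕ) [Fact p.Prime] [NeZero p]
    (hp : p ≠ 2) (h7 : ClassX7 W p) (hap : W.frobeniusTrace p = 0) (hns : ¬ Surj W p)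
    (P : W.geomTorsion p) (hP : P ≠ 0)
    (hh : haveI : NumberField ↥(W.divisionField p) := NumberField.mk
      ¬ p ∣ NumberField.classNumber ↥(fixedField
        ((MulAction.stabilizer (Field.absoluteGaloisGroup ℚ) P).map (absRestrictNormalHom (W.divisionField p)))))
    (hc3 : CleanAtP W p) : OneSignMuZeroAt W p :=
  h1 hpr W p hp h7.1 hap ((conjAAt_of_not_dvd_classNumber_stabilizerField W p hp h7 hns P hP hh hc3).fineMuZeroAt)

/-- **Door 1‴b with (c3) from the support stub** — the shape a certificate row instantiates: on M's domain, `p ∤ h(ℚ(P))` for one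
non-zero `P` ⟹ M at the pair, modulo S1, `stub_cleanAtP_goodSS` and Kobayashi's HELD print. [cite: DeoRaySujatha2023, §3 Thm. 3.9 (b)] -/
theorem oneSignMuZeroAt_of_not_dvd_classNumber_stabilizerField'
    (hpr : Kobayashi2003.thm62_63_73_signedColemanKato_zeta ∧ Kobayashi2003.thm12_signedSelmerDual_finite_torsion)
    (h1 : MinSignAbsorption) (hcl : CleanAtPOnGoodSS)
    (W : WeierstrassCurve ℚ) [W.IsElliptic] [W.IsGloballyMinimal] (p : ℕ) [Fact p.Prime] [NeZero p]
    (hp : p ≠ 2) (h7 : ClassX7 W p) (hap : W.frobeniusTrace p = 0) (hns : ¬ Surj W p)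
    (P : W.geomTorsion p) (hP : P ≠ 0)
    (hh : haveI : NumberField ↥(W.divisionField p) := NumberField.mk
      ¬ p ∣ NumberField.classNumber ↥(fixedField
        ((MulAction.stabilizer (Field.absoluteGaloisGroup ℚ) P).map (absRestrictNormalHom (W.divisionField p)))))
    : OneSignMuZeroAt W p :=
  oneSignMuZeroAt_of_not_dvd_classNumber_stabilizerField hpr h1 W p hp h7 hap hns P hP hh (hcl W p hp h7.1)


/-! ## Door 1⁗ (g12, v1.5) — PRINT-ONLY per-pair crux M and S1-free chain B, through the LEAD's LANDED lever

cruxlead-23600 g2 landed `Theorems/SignedLowerHalvesSmallImageMuZeroOneSignFinePivot{Lengths,Dichotomy,,OneSign}.lean` (p689959 ff.):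
`SmallImageFinePivot.oneSignMuZero_of_conjAAt (hKP) (hKo) (hMa) (W) (hp : p ≠ 2) (hgood) (hap) (hA : ConjAAt W p) : <M's body at the pair>`
and `smallImageMuZeroOneSign_of_facts_of_conjA` (crux M BY NAME ⟸ 3 prints ∧ Conj A on the domain), plus the converse
`fineMuZeroAt_of_oneSignMuZero` — i.e. S1 «min-sign absorption» is now a KERNEL theorem (with the print binders
`kuriharaPollack2007_selmerDual_extension_of_fineDual`, `signedSelmerInf_sub_fineSelmer_of_loc`,
`matar2020_thm11_selmerDualTorsion_pseudoIso_fineSelmerDual` in place of this file's `hCK ∧ h12`).  Composing Door 1‴ with it: -/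

/-- **Door 1⁗a — print-only per-pair crux M from `p ∤ h(ℚ(E[p]))` + `E(ℚ_p)[p] = 0`**: no stub of this file is used; binders = the
three printed facts of the LEAD's lever. [cite: CoatesSujatha2005, §3 Thm. 3.4, Lemma 3.8] [cite: KuriharaPollack2007, §1.2, §3 p. 328]
[cite: Matar2020, Thm. 1.1] [cite: Kobayashi2003, Thm. 1.2] -/
theorem oneSignMuZeroAt_of_not_dvd_classNumber_divisionField_print
    (hKP : kuriharaPollack2007_selmerDual_extension_of_fineDual) (hKo : signedSelmerInf_sub_fineSelmer_of_loc)
    (hMa : matar2020_thm11_selmerDualTorsion_pseudoIso_fineSelmerDual)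
    (W : WeierstrassCurve ℚ) [W.IsElliptic] [W.IsGloballyMinimal] (p : ℕ) [Fact p.Prime] [NeZero p]
    (hp : p ≠ 2) (h7 : ClassX7 W p) (hap : W.frobeniusTrace p = 0) (hns : ¬ Surj W p)
    (hh : haveI : NumberField ↥(W.divisionField p) := NumberField.mk
      ¬ p ∣ NumberField.classNumber ↥(W.divisionField p))
    (hc3 : CleanAtP W p) : OneSignMuZeroAt W p :=
  Theorems.SmallImageFinePivot.oneSignMuZero_of_conjAAt hKP hKo hMa W hp h7.1.1 hap
    (conjAAt_of_not_dvd_classNumber_divisionField W p hp h7 hns hh hc3)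

/-- **Door 1⁗b — print-only per-pair crux M from `p ∤ h(ℚ(P))` (ONE non-zero `P ∈ E[p]`; degree `p²−1`; = ASK-1′) + `E(ℚ_p)[p] = 0`**:
the certificate a kit row instantiates; binders = the three printed facts of the LEAD's lever, nothing else.
[cite: DeoRaySujatha2023, §3 Thm. 3.9 (b)] [cite: CoatesSujatha2005, §3 Thm. 3.4, Lemma 3.8] [cite: KuriharaPollack2007, §3 p. 328]
[cite: Matar2020, Thm. 1.1] -/
theorem oneSignMuZeroAt_of_not_dvd_classNumber_stabilizerField_print
    (hKP : kuriharaPollack2007_selmerDual_extension_of_fineDual) (hKo : signedSelmerInf_sub_fineSelmer_of_loc)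
    (hMa : matar2020_thm11_selmerDualTorsion_pseudoIso_fineSelmerDual)
    (W : WeierstrassCurve ℚ) [W.IsElliptic] [W.IsGloballyMinimal] (p : ℕ) [Fact p.Prime] [NeZero p]
    (hp : p ≠ 2) (h7 : ClassX7 W p) (hap : W.frobeniusTrace p = 0) (hns : ¬ Surj W p)
    (P : W.geomTorsion p) (hP : P ≠ 0)
    (hh : haveI : NumberField ↥(W.divisionField p) := NumberField.mk
      ¬ p ∣ NumberField.classNumber ↥(fixedField
        ((MulAction.stabilizer (Field.absoluteGaloisGroup ℚ) P).map (absRestrictNormalHom (W.divisionField p)))))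
    (hc3 : CleanAtP W p) : OneSignMuZeroAt W p :=
  Theorems.SmallImageFinePivot.oneSignMuZero_of_conjAAt hKP hKo hMa W hp h7.1.1 hap
    (conjAAt_of_not_dvd_classNumber_stabilizerField W p hp h7 hns P hP hh hc3)

/-- **Chain B as a sufficient condition for the LEAD's v3 open stub** (Conj A on the whole domain, every odd `p` — the shape of the
`hA` binder of `SmallImageFinePivot.smallImageMuZeroOneSign_of_facts_of_conjA`; restrict to `5 ≤ p` for `stub_conjA_ns_ge5`):
S3′ ∧ S2′ ⟹ Conj A on the domain. [cite: CoatesSujatha2005, §3 Conjecture A, Thm. 3.4 (proof)] -/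
theorem conjAAt_onDomain_of_torsionPointField (h3 : TorsionPointFieldMuOnSmallImageSS) (h2 : TorsionPointFieldDescent) :
    ∀ (W : WeierstrassCurve ℚ) [W.IsElliptic] [W.IsGloballyMinimal] (p : ℕ) [Fact p.Prime],
      p ≠ 2 → ClassX7 W p → ¬ W.HasCM → W.frobeniusTrace p = 0 → ¬ Surj W p → ConjAAt W p :=
  fun W _ _ p _ hp h7 hcm hap hns => h2 W p hp h7 hcm hap hns (h3 W p hp h7 hcm hap hns)

/-- **Chain B without S1 (v1.5)**: crux M BY NAME from the three prints of the LEAD's lever + S3′ (`TorsionPointFieldMuOnSmallImageSS`)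
+ S2′ (`TorsionPointFieldDescent`) — through `SmallImageFinePivot.smallImageMuZeroOneSign_of_facts_of_conjA`.  The open content of
this line is therefore exactly S3′ ∧ S2′ (chain B) resp. S3 ∧ hCS (chain A). [cite: CoatesSujatha2005, §3 Conjecture A, Thm. 3.4] -/
theorem SmallImageMuZeroOneSign_of_print_torsionPointField
    (hKP : kuriharaPollack2007_selmerDual_extension_of_fineDual) (hKo : signedSelmerInf_sub_fineSelmer_of_loc)
    (hMa : matar2020_thm11_selmerDualTorsion_pseudoIso_fineSelmerDual)
    (h3 : TorsionPointFieldMuOnSmallImageSS) (h2 : TorsionPointFieldDescent) : SmallImageMuZeroOneSign :=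
  Theorems.SmallImageFinePivot.smallImageMuZeroOneSign_of_facts_of_conjA hKP hKo hMa (conjAAt_onDomain_of_torsionPointField h3 h2)

end Summit.BirchSwinnertonDyer.BirchSwinnertonDyer.Cruxes.SmallImageMuZeroOneSign.FinePivot

end
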